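import Literature.Analysis.FluidPDE.PalasekObukhovBarriers

/-!
# Palasek 2026, §3.1 (continued): the global lower-barrier bound and the barrier ODEs

Second block of the transcription of S. Palasek, *Finite-time blow-up in an elementary model of the
3D Navier–Stokes equations*, arXiv:2605.13827 (2026), §3.1, continuing
`Literature/Analysis/FluidPDE/PalasekObukhovBarriers.lean` (definitions `zetaTop`, `zetaMid`,
`duhamelTerm`, `zetaZero`, `eta` and the bounds of Lemma 3.2): here the last clause of
**Lemma 3.2** — (eta_global_bound) `η_k(t) ≥ A_k exp(-5A_{k-1}/A_{k-2})` on `[-T,0]` — and the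
**differential equations of Definition 3.1** satisfied by the (Duhamel-defined) barriers on the open
time intervals: `ζ_K' = ½A_{K-1}ζ_K` on `(t_K,0)`, `ζ_k' = ½A_{k-1}ζ_k - δ_kζ_{k+1}²` on `(t_k,0)`
(`ζ_k` frozen below `t_k`), `ζ₀' = -μζ₀ - δ₀ζ₁²`, `η_k' = ζ_{k-1}η_k`, together with the continuity of
`ζ_k` on `(-∞,0]` that feeds the downward induction. All statements are abstract in the amplitude
data, with the smallness condition (S3) `2TA_{k-2}e^{½A_{k-2}t_{k-1}} ≤ 1` of the printed proof
(p. 9: "(exp_small)") as an explicit hypothesis. Proved theorems only; no named facts.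
Plan: cell `pub/ns-blowup`, `lit/PALASEK-FORMALISATION.md` §2–§3.
-/

open Set Filter Topology MeasureTheory intervalIntegral

namespace Literature.Analysis.FluidPDE

namespace PalasekObukhov

/-- For `λ > 0` and `a ≤ 0`: `∫_a^0 e^{λ s} ds ≤ 1/λ` (copy of the private helper of the sibling
file). [folklore] -/
private theorem integral_exp_mul_le' {lam a : ℝ} (hlam : 0 < lam) (_ha : a ≤ 0) :
    ∫ s in a..0, Real.exp (lam * s) ≤ 1 / lam := by
  have h : ∀ x ∈ uIcc a 0, HasDerivAt (fun s => Real.exp (lam * s) / lam) (Real.exp (lam * x)) x := by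
    intro x _
    have h1 : HasDerivAt (fun s => lam * s) lam x := by
      simpa using (hasDerivAt_id x).const_mul lam
    have h2 : HasDerivAt (fun s => Real.exp (lam * s)) (Real.exp (lam * x) * lam) x :=
      (Real.hasDerivAt_exp _).comp x h1
    have h3 := h2.div_const lam
    rwa [mul_div_cancel_right₀ _ hlam.ne'] at h3
  have hint : IntervalIntegrable (fun s => Real.exp (lam * s)) volume a 0 :=
    (by fun_prop : Continuous fun s => Real.exp (lam * s)).intervalIntegrable _ _
  rw [integral_eq_sub_of_hasDerivAt h hint, ← sub_div]
  apply div_le_div_of_nonneg_right _ hlam.le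
  have : Real.exp (lam * 0) = 1 := by simp
  linarith [Real.exp_pos (lam * a)]

/-- **Lemma 3.2, (eta_global_bound):** for `k ≥ 2`, on all of `[-T, 0]`,
`∫_t^0 ζ_{k-1} ≤ 5A_{k-1}/A_{k-2}` and hence `η_k(t) ≥ A_k exp(-5A_{k-1}/A_{k-2})`, given (z_bound) for
`ζ_{k-1}` (profile with rate `A_{k-2}` frozen below `τ = t_{k-1} ∈ [-T,0]`) and the smallness condition
used on p. 9 of the source: (S3) `2 T A_{k-2} e^{½A_{k-2}τ} ≤ 1` (there: `A_{k-2}/A₀ · e^{-(c/2)A_{k-2}/A_{k-3}}`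
small by (exp_small); for `k = 2`, `τ = -T` and the frozen part is absent — (S3) then still suffices).
[cite: Palasek2026ElementaryModel, §3.1 Lemma 3.2 (eta_global_bound) and its proof] -/
theorem eta_ge_exp_global {Ak Aprev App T τ : ℝ} (hAk : 0 ≤ Ak) (hAprev : 0 ≤ Aprev)
    (hApp : 0 < App) (hT : 0 < T) (hτ : τ ∈ Icc (-T) 0) {ζprev : ℝ → ℝ}
    (hcont : ContinuousOn ζprev (Icc (-T) 0))
    (hprev : ∀ s ∈ Icc (-T) 0, 0 ≤ ζprev s ∧ ζprev s ≤ 2 * Aprev * barrierProfile App τ s)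
    (hS3 : 2 * T * App * Real.exp (App / 2 * τ) ≤ 1) {t : ℝ} (ht : t ∈ Icc (-T) 0) :
    Ak * Real.exp (-(5 * Aprev / App)) ≤ eta Ak ζprev t := by
  apply eta_ge_of_integral_le hAk
  obtain ⟨htT, ht0⟩ := ht
  obtain ⟨hτT, hτ0⟩ := hτ
  have hiI : ∀ {a b : ℝ}, -T ≤ a → a ≤ b → b ≤ 0 → IntervalIntegrable ζprev volume a b := by
    intro a b ha hab hb
    exact (hcont.mono (uIcc_subset_Icc ⟨ha, by linarith⟩ ⟨by linarith, hb⟩)).intervalIntegrable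
  -- Step 1: enlarge the interval to `[-T, 0]` (integrand ≥ 0)
  have hmono : ∫ s in t..0, ζprev s ≤ ∫ s in (-T)..0, ζprev s := by
    rw [← integral_add_adjacent_intervals (hiI le_rfl htT ht0) (hiI htT ht0 le_rfl)]
    have : 0 ≤ ∫ s in (-T)..t, ζprev s :=
      integral_nonneg htT fun s hs => (hprev s ⟨hs.1, hs.2.trans ht0⟩).1
    linarith
  -- Step 2: split `[-T,0]` at `τ` and bound each piece by the profile
  have hsplit := integral_add_adjacent_intervals (hiI le_rfl hτT hτ0) (hiI hτT hτ0 le_rfl)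
  -- on `[-T, τ]`: `ζ ≤ 2A' e^{½A'' τ}` (profile frozen)
  have hI1 : ∫ s in (-T)..τ, ζprev s ≤ (τ - -T) * (2 * Aprev * Real.exp (App / 2 * τ)) := by
    have := integral_mono_on hτT (hiI le_rfl hτT hτ0) intervalIntegrable_const (fun s hs => by
      have hb := (hprev s ⟨hs.1, hs.2.trans hτ0⟩).2
      have : barrierProfile App τ s = Real.exp (App / 2 * τ) := by
        unfold barrierProfile; rw [max_eq_right hs.2]
      rw [this] at hb
      exact hb)
    rwa [intervalIntegral.integral_const, smul_eq_mul] at this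
  -- on `[τ, 0]`: `ζ ≤ 2A' e^{½A'' s}`, `∫_τ^0 e^{½A''s} ≤ 2/A''`
  have hI2 : ∫ s in τ..0, ζprev s ≤ 2 * Aprev * (2 / App) := by
    have hc2 : IntervalIntegrable (fun s => 2 * Aprev * Real.exp (App / 2 * s)) volume τ 0 :=
      (by fun_prop : Continuous fun s => 2 * Aprev * Real.exp (App / 2 * s)).intervalIntegrable _ _
    calc ∫ s in τ..0, ζprev s ≤ ∫ s in τ..0, 2 * Aprev * Real.exp (App / 2 * s) :=
          integral_mono_on hτ0 (hiI hτT hτ0 le_rfl) hc2 (fun s hs => by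
            have hb := (hprev s ⟨hτT.trans hs.1, hs.2⟩).2
            have : barrierProfile App τ s = Real.exp (App / 2 * s) := by
              unfold barrierProfile; rw [max_eq_left hs.1]
            rwa [this] at hb)
      _ = 2 * Aprev * ∫ s in τ..0, Real.exp (App / 2 * s) := by
          rw [intervalIntegral.integral_const_mul]
      _ ≤ 2 * Aprev * (1 / (App / 2)) :=
          mul_le_mul_of_nonneg_left (integral_exp_mul_le' (by positivity) hτ0) (by positivity)
      _ = 2 * Aprev * (2 / App) := by rw [one_div_div]
  -- Step 3: assemble with (S3): `(τ+T)·2A'e^{½A''τ} ≤ 2T A' e^{½A''τ} ≤ A'/A''`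
  have hJ1 : (τ - -T) * (2 * Aprev * Real.exp (App / 2 * τ)) ≤ Aprev / App := by
    have hτT' : τ - -T ≤ T := by linarith
    calc (τ - -T) * (2 * Aprev * Real.exp (App / 2 * τ))
        ≤ T * (2 * Aprev * Real.exp (App / 2 * τ)) :=
          mul_le_mul_of_nonneg_right hτT' (by positivity)
      _ = Aprev / App * (2 * T * App * Real.exp (App / 2 * τ)) := by field_simp
      _ ≤ Aprev / App * 1 := mul_le_mul_of_nonneg_left hS3 (by positivity)
      _ = Aprev / App := mul_one _
  calc ∫ s in t..0, ζprev s ≤ ∫ s in (-T)..0, ζprev s := hmono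
    _ = (∫ s in (-T)..τ, ζprev s) + ∫ s in τ..0, ζprev s := hsplit.symm
    _ ≤ Aprev / App + 2 * Aprev * (2 / App) := add_le_add (hI1.trans hJ1) hI2
    _ = 5 * Aprev / App := by ring

/-! ### The differential equations of Definition 3.1 (open time intervals) -/

/-- Below `t_k` the barrier `ζ_k` is frozen: `ζ_k(t) = ζ_k(t_k)` for `t ≤ t_k` (so `ζ_k' = 0` there).
[cite: Palasek2026ElementaryModel, §3.1 Def. 3.1] -/
theorem zetaMid_eq_of_le {Ak Aprev δk tk : ℝ} {ζnext : ℝ → ℝ} {t : ℝ} (ht : t ≤ tk) :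
    zetaMid Ak Aprev δk tk ζnext t = zetaMid Ak Aprev δk tk ζnext tk := by
  simp [zetaMid, max_eq_right ht]

/-- On `[t_k, 0]` the barrier is the Duhamel expression at `t` itself. [cite: Palasek2026ElementaryModel, §3.1 Def. 3.1] -/
theorem zetaMid_eq_of_ge {Ak Aprev δk tk : ℝ} {ζnext : ℝ → ℝ} {t : ℝ} (ht : tk ≤ t) :
    zetaMid Ak Aprev δk tk ζnext t = Ak * Real.exp (Aprev / 2 * t) + duhamelTerm Aprev δk ζnext t := by
  simp [zetaMid, max_eq_left ht]

/-- Terminal value `ζ_k(0) = A_k`. [cite: Palasek2026ElementaryModel, §3.1 Def. 3.1] -/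
theorem zetaMid_zero {Ak Aprev δk tk : ℝ} {ζnext : ℝ → ℝ} (htk : tk ≤ 0) :
    zetaMid Ak Aprev δk tk ζnext 0 = Ak := by
  simp [zetaMid, duhamelTerm, max_eq_left htk]

/-- Factorised form of the Duhamel term: `𝒩(t) = δ e^{½A't} ∫_t^0 e^{-½A's} ζ(s)² ds`.
[cite: Palasek2026ElementaryModel, §3.1 proof of Lemma 3.2 (Duhamel formula)] -/
theorem duhamelTerm_eq (Aprev δk : ℝ) (ζnext : ℝ → ℝ) (t : ℝ) :
    duhamelTerm Aprev δk ζnext t =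
      δk * (Real.exp (Aprev / 2 * t) * ∫ s in t..0, Real.exp (-(Aprev / 2) * s) * ζnext s ^ 2) := by
  unfold duhamelTerm
  congr 1
  rw [← intervalIntegral.integral_const_mul]
  refine intervalIntegral.integral_congr fun s _ => ?_
  show Real.exp (-(Aprev / 2) * (s - t)) * ζnext s ^ 2 =
    Real.exp (Aprev / 2 * t) * (Real.exp (-(Aprev / 2) * s) * ζnext s ^ 2)
  rw [← mul_assoc, ← Real.exp_add]
  congr 2; ring

/-- **Def. 3.1, the ODE of `ζ_k` on `(t_k, 0)`:** `ζ_k' = ½A_{k-1}ζ_k - δ_kζ_{k+1}(t)²`, for a next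
barrier continuous on `[t_k, 0]`. [cite: Palasek2026ElementaryModel, §3.1 Def. 3.1] -/
theorem hasDerivAt_zetaMid {Ak Aprev δk tk : ℝ} {ζnext : ℝ → ℝ}
    (hcont : ContinuousOn ζnext (Icc tk 0)) {t : ℝ} (ht : t ∈ Ioo tk 0) :
    HasDerivAt (zetaMid Ak Aprev δk tk ζnext)
      (Aprev / 2 * zetaMid Ak Aprev δk tk ζnext t - δk * ζnext t ^ 2) t := by
  obtain ⟨htk, ht0⟩ := ht
  -- the integrand `h(s) = e^{-½A's} ζ(s)²` and its primitive from `t_k`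
  set h : ℝ → ℝ := fun s => Real.exp (-(Aprev / 2) * s) * ζnext s ^ 2 with hh
  have hcont_h : ContinuousOn h (Icc tk 0) := by
    rw [hh]
    exact ((by fun_prop : Continuous fun s => Real.exp (-(Aprev / 2) * s)).continuousOn).mul
      (hcont.pow 2)
  have hint : ∀ {a b : ℝ}, a ∈ Icc tk 0 → b ∈ Icc tk 0 → IntervalIntegrable h volume a b :=
    fun ha hb => (hcont_h.mono (uIcc_subset_Icc ha hb)).intervalIntegrable
  have htI : t ∈ Icc tk 0 := ⟨htk.le, ht0.le⟩
  -- `H(u) = ∫_u^0 h = ∫_{t_k}^0 h - ∫_{t_k}^u h` has derivative `-h(t)` at `t`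
  have hHderiv : HasDerivAt (fun u => ∫ s in u..0, h s) (-h t) t := by
    have hprim : HasDerivAt (fun u => ∫ s in tk..u, h s) (h t) t :=
      intervalIntegral.integral_hasDerivAt_right (hint ⟨le_rfl, by linarith⟩ htI)
        ((hcont_h.mono Ioo_subset_Icc_self).stronglyMeasurableAtFilter isOpen_Ioo t ⟨htk, ht0⟩)
        (hcont_h.continuousAt (Icc_mem_nhds htk ht0))
    have heq : ∀ᶠ u in 𝓝 t, ∫ s in u..0, h s = (∫ s in tk..0, h s) - ∫ s in tk..u, h s := by
      filter_upwards [Icc_mem_nhds htk ht0] with u hu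
      rw [intervalIntegral.integral_interval_sub_left (hint ⟨le_rfl, by linarith [hu.1, hu.2]⟩
        ⟨by linarith [hu.1, hu.2], le_rfl⟩) (hint ⟨le_rfl, by linarith [hu.1, hu.2]⟩ hu)]
    have := (hasDerivAt_const t (∫ s in tk..0, h s)).sub hprim
    simp only [zero_sub] at this
    exact this.congr_of_eventuallyEq heq
  -- assemble: on a neighbourhood of `t`, `ζ_k(u) = A e^{½A'u} + δ e^{½A'u} H(u)`
  have hexp : HasDerivAt (fun u => Real.exp (Aprev / 2 * u)) (Real.exp (Aprev / 2 * t) * (Aprev / 2)) t := by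
    have h1 : HasDerivAt (fun u => Aprev / 2 * u) (Aprev / 2) t := by
      simpa using (hasDerivAt_id t).const_mul (Aprev / 2)
    exact (Real.hasDerivAt_exp _).comp t h1
  have hF : HasDerivAt (fun u => Ak * Real.exp (Aprev / 2 * u) +
      δk * (Real.exp (Aprev / 2 * u) * ∫ s in u..0, h s))
      (Ak * (Real.exp (Aprev / 2 * t) * (Aprev / 2)) +
        δk * ((Real.exp (Aprev / 2 * t) * (Aprev / 2)) * (∫ s in t..0, h s) +
          Real.exp (Aprev / 2 * t) * (-h t))) t :=
    (hexp.const_mul Ak).add ((hexp.mul hHderiv).const_mul δk)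
  have heqF : ∀ᶠ u in 𝓝 t, zetaMid Ak Aprev δk tk ζnext u =
      Ak * Real.exp (Aprev / 2 * u) + δk * (Real.exp (Aprev / 2 * u) * ∫ s in u..0, h s) := by
    filter_upwards [Icc_mem_nhds htk ht0] with u hu
    rw [zetaMid_eq_of_ge hu.1, duhamelTerm_eq]
  refine (hF.congr_of_eventuallyEq heqF).congr_deriv ?_
  -- identify the derivative
  rw [zetaMid_eq_of_ge htk.le, duhamelTerm_eq]
  have hcancel : Real.exp (Aprev / 2 * t) * h t = ζnext t ^ 2 := by
    show Real.exp (Aprev / 2 * t) * (Real.exp (-(Aprev / 2) * t) * ζnext t ^ 2) = ζnext t ^ 2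
    rw [← mul_assoc, ← Real.exp_add, show Aprev / 2 * t + -(Aprev / 2) * t = 0 by ring,
      Real.exp_zero, one_mul]
  linear_combination (-δk) * hcancel

/-- **Def. 3.1, the ODE of `η_k`:** `η_k' = ζ_{k-1}(t) η_k` at interior points of an interval on which
`ζ_{k-1}` is continuous. [cite: Palasek2026ElementaryModel, §3.1 Def. 3.1] -/
theorem hasDerivAt_eta {Ak a b : ℝ} {ζprev : ℝ → ℝ} (hcont : ContinuousOn ζprev (Icc a b))
    {t : ℝ} (ht : t ∈ Ioo a b) (h0 : (0 : ℝ) ∈ Icc a b) :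
    HasDerivAt (eta Ak ζprev) (ζprev t * eta Ak ζprev t) t := by
  obtain ⟨hta, htb⟩ := ht
  have hint : ∀ {c d : ℝ}, c ∈ Icc a b → d ∈ Icc a b → IntervalIntegrable ζprev volume c d :=
    fun hc hd => (hcont.mono (uIcc_subset_Icc hc hd)).intervalIntegrable
  have htI : t ∈ Icc a b := ⟨hta.le, htb.le⟩
  have hprim : HasDerivAt (fun u => ∫ s in a..u, ζprev s) (ζprev t) t :=
    intervalIntegral.integral_hasDerivAt_right (hint ⟨le_rfl, hta.le.trans htb.le⟩ htI)
      ((hcont.mono Ioo_subset_Icc_self).stronglyMeasurableAtFilter isOpen_Ioo t ⟨hta, htb⟩)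
      (hcont.continuousAt (Icc_mem_nhds hta htb))
  have hH : HasDerivAt (fun u => ∫ s in u..0, ζprev s) (-ζprev t) t := by
    have heq : ∀ᶠ u in 𝓝 t, ∫ s in u..0, ζprev s = (∫ s in a..0, ζprev s) - ∫ s in a..u, ζprev s := by
      filter_upwards [Icc_mem_nhds hta htb] with u hu
      rw [intervalIntegral.integral_interval_sub_left (hint ⟨le_rfl, hta.le.trans htb.le⟩ h0)
        (hint ⟨le_rfl, hta.le.trans htb.le⟩ hu)]
    have := (hasDerivAt_const t (∫ s in a..0, ζprev s)).sub hprim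
    simp only [zero_sub] at this
    exact this.congr_of_eventuallyEq heq
  have hE : HasDerivAt (fun u => Real.exp (-∫ s in u..0, ζprev s))
      (Real.exp (-∫ s in t..0, ζprev s) * (- -ζprev t)) t :=
    (Real.hasDerivAt_exp _).comp t hH.neg
  have := hE.const_mul Ak
  simp only [neg_neg] at this
  refine this.congr_deriv ?_
  unfold eta; ring

/-- **Def. 3.1, the ODE of `ζ_K` on `(t_K, 0)`:** `ζ_K' = ½A_{K-1}ζ_K` (no quadratic term at the top
mode of the truncation). [cite: Palasek2026ElementaryModel, §3.1 Def. 3.1 (case k = K)] -/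
theorem hasDerivAt_zetaTop {AK Aprev tK : ℝ} {t : ℝ} (ht : tK < t) :
    HasDerivAt (zetaTop AK Aprev tK) (Aprev / 2 * zetaTop AK Aprev tK t) t := by
  have h1 : HasDerivAt (fun u => Aprev / 2 * u) (Aprev / 2) t := by
    simpa using (hasDerivAt_id t).const_mul (Aprev / 2)
  have hexp := ((Real.hasDerivAt_exp _).comp t h1).const_mul AK
  have heq : ∀ᶠ u in 𝓝 t, zetaTop AK Aprev tK u = AK * Real.exp (Aprev / 2 * u) := by
    filter_upwards [Ioi_mem_nhds ht] with u hu
    simp [zetaTop, barrierProfile, max_eq_left (le_of_lt (mem_Ioi.mp hu))]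
  refine (hexp.congr_of_eventuallyEq heq).congr_deriv ?_
  simp [zetaTop, barrierProfile, max_eq_left ht.le]; ring

/-- **Def. 3.1, the ODE of `ζ₀` on `(-T, 0)`:** `ζ₀' = -μζ₀ - δ₀ζ₁(t)²` (`μ = νN₀²`), for a next barrier
continuous on `[-T, 0]`. [cite: Palasek2026ElementaryModel, §3.1 Def. 3.1] -/
theorem hasDerivAt_zetaZero {μ A0 δ0 T : ℝ} {ζone : ℝ → ℝ} (hcont : ContinuousOn ζone (Icc (-T) 0))
    {t : ℝ} (ht : t ∈ Ioo (-T) 0) :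
    HasDerivAt (zetaZero μ A0 δ0 ζone) (-μ * zetaZero μ A0 δ0 ζone t - δ0 * ζone t ^ 2) t := by
  obtain ⟨htT, ht0⟩ := ht
  set h : ℝ → ℝ := fun s => Real.exp (μ * s) * ζone s ^ 2 with hh
  have hcont_h : ContinuousOn h (Icc (-T) 0) := by
    rw [hh]
    exact ((by fun_prop : Continuous fun s => Real.exp (μ * s)).continuousOn).mul (hcont.pow 2)
  have hint : ∀ {a b : ℝ}, a ∈ Icc (-T) 0 → b ∈ Icc (-T) 0 → IntervalIntegrable h volume a b :=
    fun ha hb => (hcont_h.mono (uIcc_subset_Icc ha hb)).intervalIntegrable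
  have htI : t ∈ Icc (-T) 0 := ⟨htT.le, ht0.le⟩
  have h0I : (0 : ℝ) ∈ Icc (-T) 0 := ⟨by linarith, le_rfl⟩
  have hHderiv : HasDerivAt (fun u => ∫ s in u..0, h s) (-h t) t := by
    have hprim : HasDerivAt (fun u => ∫ s in (-T)..u, h s) (h t) t :=
      intervalIntegral.integral_hasDerivAt_right (hint ⟨le_rfl, by linarith⟩ htI)
        ((hcont_h.mono Ioo_subset_Icc_self).stronglyMeasurableAtFilter isOpen_Ioo t ⟨htT, ht0⟩)
        (hcont_h.continuousAt (Icc_mem_nhds htT ht0))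
    have heq : ∀ᶠ u in 𝓝 t, ∫ s in u..0, h s = (∫ s in (-T)..0, h s) - ∫ s in (-T)..u, h s := by
      filter_upwards [Icc_mem_nhds htT ht0] with u hu
      rw [intervalIntegral.integral_interval_sub_left (hint ⟨le_rfl, by linarith⟩ h0I)
        (hint ⟨le_rfl, by linarith⟩ hu)]
    have := (hasDerivAt_const t (∫ s in (-T)..0, h s)).sub hprim
    simp only [zero_sub] at this
    exact this.congr_of_eventuallyEq heq
  -- `ζ₀(u) = e^{-μu} (A₀ + δ₀ ∫_u^0 e^{μs} ζ₁(s)² ds)` near `t`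
  have hexp : HasDerivAt (fun u => Real.exp (-(μ * u))) (Real.exp (-(μ * t)) * (-μ)) t := by
    have h1 : HasDerivAt (fun u => -(μ * u)) (-μ) t := by
      simpa [neg_mul] using (hasDerivAt_id t).const_mul (-μ)
    exact (Real.hasDerivAt_exp _).comp t h1
  have hF : HasDerivAt (fun u => Real.exp (-(μ * u)) * (A0 + δ0 * ∫ s in u..0, h s))
      (Real.exp (-(μ * t)) * (-μ) * (A0 + δ0 * ∫ s in t..0, h s) +
        Real.exp (-(μ * t)) * (δ0 * (-h t))) t :=
    hexp.mul ((hHderiv.const_mul δ0).const_add A0)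
  have hfactor : ∀ u : ℝ, zetaZero μ A0 δ0 ζone u =
      Real.exp (-(μ * u)) * (A0 + δ0 * ∫ s in u..0, h s) := by
    intro u
    have key : ∫ s in u..0, Real.exp (μ * (s - u)) * ζone s ^ 2 =
        Real.exp (-(μ * u)) * ∫ s in u..0, h s := by
      rw [← intervalIntegral.integral_const_mul]
      refine intervalIntegral.integral_congr fun s _ => ?_
      show Real.exp (μ * (s - u)) * ζone s ^ 2 = Real.exp (-(μ * u)) * (Real.exp (μ * s) * ζone s ^ 2)
      rw [← mul_assoc, ← Real.exp_add]
      congr 2; ring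
    unfold zetaZero
    rw [key]; ring
  have heqF : ∀ᶠ u in 𝓝 t, zetaZero μ A0 δ0 ζone u =
      Real.exp (-(μ * u)) * (A0 + δ0 * ∫ s in u..0, h s) :=
    Filter.Eventually.of_forall hfactor
  refine (hF.congr_of_eventuallyEq heqF).congr_deriv ?_
  rw [hfactor t]
  have hcancel : Real.exp (-(μ * t)) * h t = ζone t ^ 2 := by
    show Real.exp (-(μ * t)) * (Real.exp (μ * t) * ζone t ^ 2) = ζone t ^ 2
    rw [← mul_assoc, ← Real.exp_add, show -(μ * t) + μ * t = 0 by ring, Real.exp_zero, one_mul]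
  linear_combination (-δ0) * hcancel

/-- Continuity of `ζ_k` on `(-∞, 0]` when `ζ_{k+1}` is continuous on `[t_k, 0]` and `t_k ≤ 0` — the
regularity needed to feed `ζ_k` as `ζnext` into the step for `ζ_{k-1}` (downward induction of
Lemma 3.2). [cite: Palasek2026ElementaryModel, §3.1 Def. 3.1 and Lemma 3.2 (downward induction)] -/
theorem continuousOn_zetaMid {Ak Aprev δk tk : ℝ} {ζnext : ℝ → ℝ} (htk : tk ≤ 0)
    (hcont : ContinuousOn ζnext (Icc tk 0)) :
    ContinuousOn (zetaMid Ak Aprev δk tk ζnext) (Iic 0) := by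
  set h : ℝ → ℝ := fun s => Real.exp (-(Aprev / 2) * s) * ζnext s ^ 2 with hh
  have hcont_h : ContinuousOn h (Icc tk 0) := by
    rw [hh]
    exact ((by fun_prop : Continuous fun s => Real.exp (-(Aprev / 2) * s)).continuousOn).mul
      (hcont.pow 2)
  -- the primitive `u ↦ ∫_{t_k}^u h` is continuous on `[t_k, 0]`
  have hprim : ContinuousOn (fun u => ∫ s in tk..u, h s) (Icc tk 0) := by
    have := intervalIntegral.continuousOn_primitive_interval (μ := volume) (a := tk) (b := 0)
      (f := h) ((hcont_h.mono (uIcc_of_le htk).le).integrableOn_compact isCompact_uIcc)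
    rwa [uIcc_of_le htk] at this
  have hint0 : IntervalIntegrable h volume tk 0 := (hcont_h.mono (uIcc_of_le htk).le).intervalIntegrable
  -- hence `F(u) = A e^{½A'u} + δ e^{½A'u} (∫_{t_k}^0 h - ∫_{t_k}^u h)` is continuous on `[t_k, 0]`
  set F : ℝ → ℝ := fun u => Ak * Real.exp (Aprev / 2 * u) +
    δk * (Real.exp (Aprev / 2 * u) * ((∫ s in tk..0, h s) - ∫ s in tk..u, h s)) with hF
  have hFcont : ContinuousOn F (Icc tk 0) := by
    rw [hF]
    apply ContinuousOn.add
    · exact (by fun_prop : Continuous fun u => Ak * Real.exp (Aprev / 2 * u)).continuousOn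
    · exact continuousOn_const.mul
        (((by fun_prop : Continuous fun u => Real.exp (Aprev / 2 * u)).continuousOn).mul
          (continuousOn_const.sub hprim))
  -- and `ζ_k = F ∘ (max · t_k)` on `(-∞, 0]`
  have hmaps : MapsTo (fun t => max t tk) (Iic 0) (Icc tk 0) :=
    fun t ht => ⟨le_max_right _ _, max_le ht htk⟩
  have hcomp := hFcont.comp ((continuous_id.max continuous_const).continuousOn) hmaps
  refine hcomp.congr fun t ht => ?_
  have hm : max t tk ∈ Icc tk 0 := hmaps ht
  show zetaMid Ak Aprev δk tk ζnext t = F (max t tk)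
  rw [hF]
  simp only
  rw [intervalIntegral.integral_interval_sub_left hint0
    ((hcont_h.mono (uIcc_subset_Icc ⟨le_rfl, htk⟩ hm)).intervalIntegrable)]
  unfold zetaMid
  rw [duhamelTerm_eq]

end PalasekObukhov

end Literature.Analysis.FluidPDE
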